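import Summits.QuantumFields.GaugeBoot.WordCanonD4
import Summits.QuantumFields.GaugeBoot.MMRowSU2
import HarnessLib

/-!
# Rows as data in `D = 4`: the `SU(2)` loop-equation row of a marked word, computed, with ONE soundness theorem

Cell `pub-gaugeboot` (HOME `run/shared/lean/pub/pub-gaugeboot/`), seat lean2 — the `D = 4` companion of `MMRowSU2.lean` (design
note `HOME/pub-gaugeboot-lean2/LEQ-SCALING.md`), for the cell's `D = 4` `SU(2)` equality systems: glyz-c1-4D (242 rows; the `𝓔`
behind the certified 4D windows C20–C31), glyz-c2-4D (1056 rows), kz-L2-4D (1120 rows).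

HONEST FRAMING (page 1 of every file of this cell): certified bounds on lattice expectations at STATED coupling, gauge
group, dimension and torus size; NOT a mass gap, NOT a continuum limit, NOT a string tension, NOT large `N`; NOT
Yang–Mills-summit-bearing (barriers `FixedCouplingUltralocality`, `PerturbativeInvisibility`).

## Content (verbatim `D = 4` transcription of `MMRowSU2.lean`; variables `Rung0D4.W β L w` of lean1's `Rung0D4Binding`)

* `ERow4`, `rowSum4 β L r = Σ (c0 + c1·β/8)·Rung0D4.W β L w`; `ERow4.merge/clean/relabel` (codes of `WordCanonD4.Word.canonW4`)
  with `rowSum4_merge/_clean/_relabel`;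
* `mmRowSU2D4 X cs` — eng1's `mm_row` for `SU(2)` in `D = 4` (six plaquettes through the marked link `(0, +e₀)`) with
  `rowSum4_mmRowSU2D4 : disp X = 0 → X.DispBound B → B + 2 ≤ L → rowSum4 β L (mmRowSU2D4 X cs) = 0`
  (`LoopEquationSU2Loops.loopEquation_su_two_loops`, any `d`);
* `su2_rawTrace4`, `traceRowSU2D4`, Boolean `trOK4` (pair scripts coded by `pmDecode4`: six transpositions, reflection,
  reversals, reductions, rotations, translations of `ℤ⁴`) with `rowSum4_traceRowSU2D4`;
* family API `SDCheck4` / `rowSum4_of_SDCheck4`, `TrData4` / `TRCheck4` / `rowSum4_of_TRCheck4`.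
Everything is `[folklore]`.
-/

noncomputable section

open MeasureTheory
open Literature.MathematicalPhysics.QuantumFieldTheory

namespace Summit.QuantumFields.GaugeBoot

/-! ## Rows as data and their value -/

/-- A row: terms `(label word, c0, c1)`, coefficient `c0 + c1·β/8` (G1's `[c0, c1]`). [folklore] -/
abbrev ERow4 : Type := List (Word 4 × ℚ × ℚ)

/-- The value of a row at standard coupling `β` on `(ℤ/L)³`: `Σ (c0 + c1·β/8)·⟨W_0(w)⟩_β` (same expression as lean1's
`GLYZc1D3.rowSum4`). [folklore] -/
def rowSum4 (β : ℝ) (L : ℕ) [NeZero L] (r : ERow4) : ℝ :=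
  (r.map fun t => (((t.2.1 : ℚ) : ℝ) + ((t.2.2 : ℚ) : ℝ) * (β / 8)) * Rung0D4.W β L t.1).sum

variable (β : ℝ) (L : ℕ) [NeZero L]

/-- Unfolding lemma `rowSum4_nil`. [folklore] -/
@[simp] theorem rowSum4_nil : rowSum4 β L [] = 0 := rfl

/-- Unfolding lemma `rowSum4_cons`. [folklore] -/
@[simp] theorem rowSum4_cons (t : Word 4 × ℚ × ℚ) (r : ERow4) :
    rowSum4 β L (t :: r) = (((t.2.1 : ℚ) : ℝ) + ((t.2.2 : ℚ) : ℝ) * (β / 8)) * Rung0D4.W β L t.1 + rowSum4 β L r := by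
  simp [rowSum4]

/-- `rowSum4` is additive under concatenation. [folklore] -/
@[simp] theorem rowSum4_append (r r' : ERow4) : rowSum4 β L (r ++ r') = rowSum4 β L r + rowSum4 β L r' := by
  simp [rowSum4, List.sum_append]

namespace ERow4

/-- Add one term, merging with an existing term of the same label. [folklore] -/
def addTerm : ERow4 → Word 4 × ℚ × ℚ → ERow4
  | [], t => [t]
  | u :: r, t => if u.1 = t.1 then (u.1, u.2.1 + t.2.1, u.2.2 + t.2.2) :: r else u :: addTerm r t

/-- Merge equal labels (first occurrence keeps its place). [folklore] -/
def merge (r : ERow4) : ERow4 := r.foldl addTerm []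

/-- Drop the terms with zero coefficient. [folklore] -/
def clean (r : ERow4) : ERow4 := r.filter fun t => t.2.1 ≠ 0 ∨ t.2.2 ≠ 0

/-- Relabel one term by a witness code: a CLOSED word is carried to `canonW4 c`; anything else is left alone (so that the
value is preserved unconditionally). [folklore] -/
def relabelTerm (c : ℕ) (t : Word 4 × ℚ × ℚ) : Word 4 × ℚ × ℚ :=
  if Word.disp t.1 = 0 then (t.1.canonW4 c, t.2) else t

/-- Relabel the terms by a list of witness codes, consumed in order (missing codes default to `0` = free reduction). [folklore] -/
def relabel : List ℕ → ERow4 → ERow4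
  | _, [] => []
  | [], t :: r => relabelTerm 0 t :: relabel [] r
  | c :: cs, t :: r => relabelTerm c t :: relabel cs r

end ERow4

/-- `addTerm` adds the value of the term. [folklore] -/
theorem rowSum4_addTerm (r : ERow4) (t : Word 4 × ℚ × ℚ) :
    rowSum4 β L (r.addTerm t) = rowSum4 β L r + rowSum4 β L [t] := by
  induction r with
  | nil => simp [ERow4.addTerm]
  | cons u r ih =>
    simp only [ERow4.addTerm]
    split_ifs with h
    · simp only [rowSum4_cons, rowSum4_nil, h]
      push_cast
      ring
    · simp only [rowSum4_cons, ih, rowSum4_nil]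
      ring

/-- Merging preserves the value. [folklore] -/
theorem rowSum4_merge (r : ERow4) : rowSum4 β L r.merge = rowSum4 β L r := by
  suffices h : ∀ (acc : ERow4), rowSum4 β L (r.foldl ERow4.addTerm acc) = rowSum4 β L acc + rowSum4 β L r by
    simpa [ERow4.merge] using h []
  induction r with
  | nil => intro acc; simp
  | cons t r ih =>
    intro acc
    simp only [List.foldl_cons, ih, rowSum4_addTerm, rowSum4_cons, rowSum4_nil]
    ring

/-- Cleaning preserves the value. [folklore] -/
theorem rowSum4_clean (r : ERow4) : rowSum4 β L r.clean = rowSum4 β L r := by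
  induction r with
  | nil => simp [ERow4.clean]
  | cons t r ih =>
    simp only [ERow4.clean, List.filter_cons] at ih ⊢
    split_ifs with h
    · simp only [rowSum4_cons, ih]
    · simp only [decide_eq_true_eq, not_or, not_not] at h
      simp only [rowSum4_cons, ih, h.1, h.2]
      push_cast
      ring

/-- Relabelling one term preserves the value (`W_canonW`). [folklore] -/
theorem rowSum4_relabelTerm (c : ℕ) (t : Word 4 × ℚ × ℚ) : rowSum4 β L [ERow4.relabelTerm c t] = rowSum4 β L [t] := by
  unfold ERow4.relabelTerm
  split_ifs with h
  · simp only [rowSum4_cons, rowSum4_nil, W4_canonW4 β L c t.1 h]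
  · rfl

/-- Relabelling preserves the value, for EVERY code list. [folklore] -/
theorem rowSum4_relabel : ∀ (cs : List ℕ) (r : ERow4), rowSum4 β L (ERow4.relabel cs r) = rowSum4 β L r
  | _, [] => by simp [ERow4.relabel]
  | [], t :: r => by
    have ht := rowSum4_relabelTerm β L 0 t
    simp only [rowSum4_cons, rowSum4_nil, add_zero] at ht
    rw [ERow4.relabel, rowSum4_cons, rowSum4_cons, rowSum4_relabel [] r, ht]
  | c :: cs, t :: r => by
    have ht := rowSum4_relabelTerm β L c t
    simp only [rowSum4_cons, rowSum4_nil, add_zero] at ht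
    rw [ERow4.relabel, rowSum4_cons, rowSum4_cons, rowSum4_relabel cs r, ht]

/-! ## The single-link Schwinger–Dyson row of a marked word (`SU(2)`, eng1 `mm_row` normalisation) -/

/-- Raw terms at letter `k` of the marked word `X` (link `(0, +e₀)`): forward traversal ↦ `¼·X + ½·(X[0,k)·X[k,n)⁻¹)`,
backward traversal ↦ `−¼·X − ½·(X[0,k]·X(k,n)⁻¹)` (occurrences decided on `ℤ³`). [folklore] -/
def sdTermsAt4 (X : Word 4) (k : ℕ) : ERow4 :=
  (if X.fwdOccZ 0 k then [(X, 1 / 4, 0), (X.take k ++ Word.reverse (X.drop k), 1 / 2, 0)] else []) ++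
    (if X.bwdOccZ 0 k then [(X, -(1 / 4), 0), (X.take (k + 1) ++ Word.reverse (X.drop (k + 1)), -(1 / 2), 0)] else [])

/-- Raw plaquette terms through the marked link in the plane `(0, ν)`: `(β/8)·(X·P̃ − X·P̃⁻¹)` for both orientations
`P̃ = +0 ±ν −0 ∓ν`. [folklore] -/
def sdPlaqTerms4 (X : Word 4) (ν : Fin 4) : ERow4 :=
  [(X ++ plaqWord 0 ν true, 0, 1), (X ++ (plaqWord 0 ν true).reverse, 0, -1),
    (X ++ plaqWord 0 ν false, 0, 1), (X ++ (plaqWord 0 ν false).reverse, 0, -1)]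

/-- All raw terms of the row of `X` (`¼ ×` the identity `loopEquation_su_two_loops`). [folklore] -/
def sdTermsRaw4 (X : Word 4) : ERow4 :=
  (List.range X.length).flatMap (sdTermsAt4 X) ++ (sdPlaqTerms4 X 1 ++ sdPlaqTerms4 X 2 ++ sdPlaqTerms4 X 3)

/-- **eng1's `mm_row` for `SU(2)`**: the row of the marked closed word `X`, every term relabelled by the witness codes
`cs` (in the order of `sdTermsRaw4`), equal labels merged, zero coefficients dropped. [folklore] -/
def mmRowSU2D4 (X : Word 4) (cs : List ℕ) : ERow4 := (ERow4.relabel cs (sdTermsRaw4 X)).merge.clean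

/-- `rowSum4` of a `flatMap` over `range n` is a `Finset.range` sum. [folklore] -/
theorem rowSum4_flatMap_range (f : ℕ → ERow4) :
    ∀ n : ℕ, rowSum4 β L ((List.range n).flatMap f) = ∑ k ∈ Finset.range n, rowSum4 β L (f k)
  | 0 => by simp
  | n + 1 => by
    rw [List.range_succ, List.flatMap_append, rowSum4_append, rowSum4_flatMap_range f n, Finset.sum_range_succ]
    simp

variable {L}

/-- **The raw terms sum to zero**: `¼ ×` `loopEquation_su_two_loops` at the link `(0, +e₀)` for a closed marked word with
displacement bound `B` on a torus with `B + 2 ≤ L` (standard coupling `β`, tree coupling `β/2`). [folklore] -/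
theorem rowSum4_sdTermsRaw4 (X : Word 4) (hX : Word.disp X = 0) {B : ℕ} (hB : X.DispBound B) (hL : B + 2 ≤ L) :
    rowSum4 β L (sdTermsRaw4 X) = 0 := by
  have h := loopEquation_su_two_loops_of_dispBound (L := L) (β / (2 : ℕ)) (0 : Site 4 L) 0 X
    (Word.endpoint_eq_self_of_disp 0 hX) hB hL
  have hW : ∀ v : Word 4,
      wilsonExpectation (suRep 2) (β / (2 : ℕ)) (wordLoop (suRep 2) (0 : Site 4 L) v) = Rung0D4.W β L v := fun v => rfl
  simp only [hW, univ_erase_zero_fin_four] at h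
  rw [Finset.sum_insert (show (1 : Fin 4) ∉ ({2, 3} : Finset (Fin 4)) by decide),
    Finset.sum_pair (show (2 : Fin 4) ≠ 3 by decide), Finset.sum_filter, Finset.sum_filter,
    ← Finset.sum_sub_distrib] at h
  simp only [Fintype.sum_bool] at h
  have hat : ∀ k, rowSum4 β L (sdTermsAt4 X k) = (1 / 4 : ℝ) *
      ((if X.fwdOccZ 0 k then Rung0D4.W β L X + 2 * Rung0D4.W β L (X.take k ++ Word.reverse (X.drop k)) else 0) -
        (if X.bwdOccZ 0 k then Rung0D4.W β L X + 2 * Rung0D4.W β L (X.take (k + 1) ++ Word.reverse (X.drop (k + 1)))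
          else 0)) := by
    intro k
    unfold sdTermsAt4
    split_ifs <;> simp only [rowSum4_append, rowSum4_cons, rowSum4_nil, List.nil_append, List.append_nil] <;>
      push_cast <;> ring
  rw [sdTermsRaw4, rowSum4_append, rowSum4_append, rowSum4_append, rowSum4_flatMap_range]
  simp only [hat]
  rw [← Finset.mul_sum]
  simp only [sdPlaqTerms4, rowSum4_cons, rowSum4_nil]
  push_cast at h ⊢
  linear_combination (1 / 4 : ℝ) * h

/-- **Soundness of the computed row**: `rowSum4 β L (mmRowSU2D4 X cs) = 0` for every closed marked word `X` with displacement
bound `B`, every witness list `cs`, every torus `(ℤ/L)³` with `B + 2 ≤ L`, every real `β`. [folklore] -/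
theorem rowSum4_mmRowSU2D4 (X : Word 4) (cs : List ℕ) (hX : Word.disp X = 0) {B : ℕ} (hB : X.DispBound B)
    (hL : B + 2 ≤ L) : rowSum4 β L (mmRowSU2D4 X cs) = 0 := by
  rw [mmRowSU2D4, rowSum4_clean, rowSum4_merge, rowSum4_relabel, rowSum4_sdTermsRaw4 β X hX hB hL]

/-! ## `SU(2)` trace rows: differences of two trace identities with the same double trace -/

/-- **`SU(2)` raw trace relation, integrated, `D = 4`**: for closed `C₁, C₂` read from the integer point `v`,
`2·⟨W_v(C₁)·W_v(C₂)⟩ = ⟨W_v(C₁·C₂)⟩ + ⟨W_v(C₁·C₂⁻¹)⟩` (as `GLYZc1D3TraceRowsA.su2_rawTrace` in `D = 3`). [folklore] -/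
theorem su2_rawTrace4 (v : Fin 4 → ℤ) (C₁ C₂ : Word 4) (h₁ : Word.disp C₁ = 0) (h₂ : Word.disp C₂ = 0) :
    2 * pairExp (suRep 2) (β / (2 : ℕ)) L ⟨v, C₁⟩ ⟨v, C₂⟩ =
      wilsonExpectation (suRep 2) (β / (2 : ℕ)) (wordLoop (suRep 2) (castZ v : Site 4 L) (C₁ ++ C₂)) +
        wilsonExpectation (suRep 2) (β / (2 : ℕ)) (wordLoop (suRep 2) (castZ v : Site 4 L) (C₁ ++ Word.reverse C₂)) := by
  unfold pairExp wilsonExpectation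
  rw [← integral_add (integrable_wordLoop (suRep 2) (continuous_suRep 2) _ _ _)
    (integrable_wordLoop (suRep 2) (continuous_suRep 2) _ _ _), ← integral_const_mul]
  exact integral_congr_ae (ae_of_all _ fun U => two_mul_wordLoop_mul_su_two (castZ v) C₁ C₂ h₁ h₂ U)


/-- Decode one pair-script code (`D = 4`): `1 … 6` joint transpositions `(0 1), (0 2), (1 2), (0 3), (1 3), (2 3)`;
`10` joint reflection of axis `0`; `11/12` reversal of the left/right component; `13/14` free reduction left/right;
`100 + k` / `200 + k`: `k` one-letter rotations left/right; `10⁶ + m`: joint translation by `t`, `tᵢ = (m / 64ⁱ) % 64 − 32`.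
[folklore] -/
def pmDecode4one (c : ℕ) : List (PMove 4) :=
  if c = 1 then [PMove.perm (Equiv.swap 0 1)] else if c = 2 then [PMove.perm (Equiv.swap 0 2)]
  else if c = 3 then [PMove.perm (Equiv.swap 1 2)] else if c = 4 then [PMove.perm (Equiv.swap 0 3)]
  else if c = 5 then [PMove.perm (Equiv.swap 1 3)] else if c = 6 then [PMove.perm (Equiv.swap 2 3)]
  else if c = 10 then [PMove.refl0]
  else if c = 11 then [PMove.revL] else if c = 12 then [PMove.revR]
  else if c = 13 then [PMove.redL] else if c = 14 then [PMove.redR]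
  else if 100 ≤ c ∧ c < 200 then List.replicate (c - 100) PMove.rotL
  else if 200 ≤ c ∧ c < 300 then List.replicate (c - 200) PMove.rotR
  else if 1000000 ≤ c then
    [PMove.shift ![((c - 1000000) % 64 : ℕ) - 32, ((c - 1000000) / 64 % 64 : ℕ) - 32,
      ((c - 1000000) / 4096 % 64 : ℕ) - 32, ((c - 1000000) / 262144 % 64 : ℕ) - 32]]
  else []

/-- Decode a pair script. [folklore] -/
def pmDecode4 (cs : List ℕ) : List (PMove 4) := cs.flatMap pmDecode4one

/-- The positioned pair `(C₁, C₂)` read from the origin of `ℤ³`. [folklore] -/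
def pairAt04 (C₁ C₂ : Word 4) : PLoop 4 × PLoop 4 := (⟨0, C₁⟩, ⟨0, C₂⟩)

/-- **Side condition of a trace row** (Boolean, for `decide`): the four words are closed, both scripts are admissible
along their runs, and they carry the two positioned pairs to the same pair up to order. [folklore] -/
def trOK4 (C₁ C₂ D₁ D₂ : Word 4) (sa sb : List ℕ) : Bool :=
  decide (Word.disp C₁ = 0) && decide (Word.disp C₂ = 0) && decide (Word.disp D₁ = 0) && decide (Word.disp D₂ = 0) &&
    decide (PMove.closedAlong (pmDecode4 sa) (pairAt04 C₁ C₂)) && decide (PMove.closedAlong (pmDecode4 sb) (pairAt04 D₁ D₂)) &&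
    (decide (PMove.run (pmDecode4 sa) (pairAt04 C₁ C₂) = PMove.run (pmDecode4 sb) (pairAt04 D₁ D₂)) ||
      decide (PMove.run (pmDecode4 sa) (pairAt04 C₁ C₂) = (PMove.run (pmDecode4 sb) (pairAt04 D₁ D₂)).swap))

/-- **The trace row** of two decompositions with the same double trace: `w(C₁C₂) + w(C₁C₂⁻¹) − w(D₁D₂) − w(D₁D₂⁻¹)`
(relabelled by `cs`, merged, cleaned; G1 `su2_trace_rows` + `eliminate_su2_double_traces`). [folklore] -/
def traceRowSU2D4 (C₁ C₂ D₁ D₂ : Word 4) (cs : List ℕ) : ERow4 :=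
  (ERow4.relabel cs [(C₁ ++ C₂, 1, 0), (C₁ ++ Word.reverse C₂, 1, 0), (D₁ ++ D₂, -1, 0),
    (D₁ ++ Word.reverse D₂, -1, 0)]).merge.clean

/-- **Soundness of the trace row**: it vanishes on every torus and at every coupling when `trOK4` holds. [folklore] -/
theorem rowSum4_traceRowSU2D4 (C₁ C₂ D₁ D₂ : Word 4) (sa sb cs : List ℕ) (h : trOK4 C₁ C₂ D₁ D₂ sa sb = true) :
    rowSum4 β L (traceRowSU2D4 C₁ C₂ D₁ D₂ cs) = 0 := by
  simp only [trOK4, Bool.and_eq_true, Bool.or_eq_true, decide_eq_true_eq] at h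
  obtain ⟨⟨⟨⟨⟨⟨h₁, h₂⟩, h₃⟩, h₄⟩, ha⟩, hb⟩, hrun⟩ := h
  have ea := su2_rawTrace4 β (L := L) 0 C₁ C₂ h₁ h₂
  have eb := su2_rawTrace4 β (L := L) 0 D₁ D₂ h₃ h₄
  have hW : ∀ v : Word 4,
      wilsonExpectation (suRep 2) (β / (2 : ℕ)) (wordLoop (suRep 2) (castZ 0 : Site 4 L) v) = Rung0D4.W β L v := by
    intro v; rw [castZ_zero]; rfl
  simp only [hW] at ea eb
  have pa := pairExp_run (L := L) (suRep 2) (continuous_suRep 2) (β / (2 : ℕ)) (pmDecode4 sa) (pairAt04 C₁ C₂) ha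
  have pb := pairExp_run (L := L) (suRep 2) (continuous_suRep 2) (β / (2 : ℕ)) (pmDecode4 sb) (pairAt04 D₁ D₂) hb
  have hpq : pairExp (suRep 2) (β / (2 : ℕ)) L (⟨0, C₁⟩ : PLoop 4) ⟨0, C₂⟩ =
      pairExp (suRep 2) (β / (2 : ℕ)) L (⟨0, D₁⟩ : PLoop 4) ⟨0, D₂⟩ := by
    change pairExp (suRep 2) (β / (2 : ℕ)) L (pairAt04 C₁ C₂).1 (pairAt04 C₁ C₂).2 =
      pairExp (suRep 2) (β / (2 : ℕ)) L (pairAt04 D₁ D₂).1 (pairAt04 D₁ D₂).2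
    rw [← pa, ← pb]
    rcases hrun with e | e
    · rw [e]
    · rw [e, Prod.fst_swap, Prod.snd_swap, pairExp_comm]
  rw [traceRowSU2D4, rowSum4_clean, rowSum4_merge, rowSum4_relabel]
  simp only [rowSum4_cons, rowSum4_nil]
  change 2 * pairExp (suRep 2) (β / (2 : ℕ)) L (⟨0, C₁⟩ : PLoop 4) ⟨0, C₂⟩ = _ at ea
  change 2 * pairExp (suRep 2) (β / (2 : ℕ)) L (⟨0, D₁⟩ : PLoop 4) ⟨0, D₂⟩ = _ at eb
  push_cast
  linear_combination eb - ea + 2 * hpq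

/-! ## Families of rows as data: the checks a data module runs by `decide` -/

/-- The side condition of a list of SD rows `(marked word, witness codes)`: every marked word is closed with displacement
bound `B` (Boolean, for `decide`). [folklore] -/
def SDCheck4 (B : ℕ) (rs : List (Word 4 × List ℕ)) : Bool :=
  rs.all fun r => decide (Word.disp r.1 = 0) && decide (r.1.DispBound B)

/-- **All rows of a checked SD family vanish** on every torus `(ℤ/L)³` with `B + 2 ≤ L`. [folklore] -/
theorem rowSum4_of_SDCheck4 {B : ℕ} {rs : List (Word 4 × List ℕ)} (h : SDCheck4 B rs = true) (hL : B + 2 ≤ L) :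
    ∀ r ∈ rs, rowSum4 β L (mmRowSU2D4 r.1 r.2) = 0 := by
  intro r hr
  have h' := List.all_eq_true.1 h r hr
  simp only [Bool.and_eq_true, decide_eq_true_eq] at h'
  exact rowSum4_mmRowSU2D4 β r.1 r.2 h'.1 h'.2 hL

/-- The data of one trace row: two decompositions `(C₁, C₂)`, `(D₁, D₂)` (read from the origin), their pair scripts
`sa`, `sb` and the witness codes `cs` of the four single-loop terms. [folklore] -/
structure TrData4 where
  /-- first decomposition, first component -/
  C₁ : Word 4
  /-- first decomposition, second component -/
  C₂ : Word 4
  /-- second decomposition, first component -/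
  D₁ : Word 4
  /-- second decomposition, second component -/
  D₂ : Word 4
  /-- pair script for `(C₁, C₂)` (`pmDecode4`) -/
  sa : List ℕ
  /-- pair script for `(D₁, D₂)` -/
  sb : List ℕ
  /-- witness codes of the four single-loop terms -/
  cs : List ℕ

/-- The row of a trace datum. [folklore] -/
def TrData4.row (t : TrData4) : ERow4 := traceRowSU2D4 t.C₁ t.C₂ t.D₁ t.D₂ t.cs

/-- The side condition of a list of trace data (Boolean, for `decide`). [folklore] -/
def TRCheck4 (ts : List TrData4) : Bool := ts.all fun t => trOK4 t.C₁ t.C₂ t.D₁ t.D₂ t.sa t.sb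

variable (L) in
/-- **All rows of a checked trace family vanish** on every torus and at every coupling. [folklore] -/
theorem rowSum4_of_TRCheck4 {ts : List TrData4} (h : TRCheck4 ts = true) : ∀ t ∈ ts, rowSum4 β L t.row = 0 := by
  intro t ht
  exact rowSum4_traceRowSU2D4 β t.C₁ t.C₂ t.D₁ t.D₂ t.sa t.sb t.cs (List.all_eq_true.1 h t ht)


/-! ## Example (closed computation; witness codes found by search outside the kernel — soundness holds for any codes) -/

/-- eng1 G1 row 0 of every 4D `SU(2)` family — the plaquette equation: marked word `+0 +1 −0 −1`; output in G1 labels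
`abAB:[3/4,0] abABabAB:[0,1] 1:[0,-1] abaBAbAB:[0,1] aabAAB:[0,-1] abABacAC:[0,4] abAcBC:[0,-4]` (the two out-of-plane
directions merge into the coefficients `±4`). [folklore] -/
example : mmRowSU2D4 [.fwd 0, .fwd 1, .bwd 0, .bwd 1]
      [0, 512, 0, 0, 229392, 67088, 0, 99856, 4, 99860, 131328, 99472, 131336, 99480] =
    [([.fwd 0, .fwd 1, .bwd 0, .bwd 1], 3 / 4, 0), ([.fwd 0, .fwd 1, .bwd 0, .bwd 1, .fwd 0, .fwd 1, .bwd 0, .bwd 1], 0, 1),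
      ([], 0, -1), ([.fwd 0, .fwd 1, .fwd 0, .bwd 1, .bwd 0, .fwd 1, .bwd 0, .bwd 1], 0, 1),
      ([.fwd 0, .fwd 0, .fwd 1, .bwd 0, .bwd 0, .bwd 1], 0, -1),
      ([.fwd 0, .fwd 1, .bwd 0, .bwd 1, .fwd 0, .fwd 2, .bwd 0, .bwd 2], 0, 4),
      ([.fwd 0, .fwd 1, .bwd 0, .fwd 2, .bwd 1, .bwd 2], 0, -4)] := by
  decide +kernel

end Summit.QuantumFields.GaugeBoot

end
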